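import Summits.Ventures.QEC.Census.CertBits
import Summits.Ventures.QEC.Census.KernelReplayFastSound
import HarnessLib

/-!
# Fold (Plotkin `(u|u+v)`) enumeration of low-weight kernel words of two-block torus codes — definitions

Cell `qec`, PARTITION row type-11 ("kernel C").  A two-block code on the torus `ℤ_ℓ × ℤ_m` (qubits
`(blk, a, b) ↦ blk·ℓm + a·m + b`, checks `(a, b) ↦ a·m + b`; exponent lists `A`, `B`; column `j = (blk,a,b)` of
`H^X` has the check `(a − i, b − k)` for every `(i,k)` in `A` (left block) / `B` (right block) — the tree's
`BB.Code.toMatrix` convention `toMatrix (xⁱyᵏ) r c = 1 ↔ c = r + (i,k)`) FOLDS along an index-2 subgroup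
(`x^{ℓ/2}` or `y^{m/2}`) onto the code with the reduced exponents on the half torus.  Words are binary
numerals (`Census/CertBits.lean`: bit `j` = qubit `j`), low-weight words are also carried as index lists.
This file: the computable objects only — index arithmetic (`foldIdx`, `emb`, `partner`, `transIdx`),
xor-of-list maps (`xorIdx`), the structural linear map `lin` (proof-side twin), columns / syndromes, the
CERTIFYING Gaussian elimination (`gauss` computes, `pivOK` verifies — only the verifier carries lemmas),
the include/skip subset scan, the anchored matcher against a `KRupFast.Store` of class representatives,
and the per-fibre enumerator `fiber`.  Soundness: `Census/FoldSound*.lean`.  Everything is structural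
recursion (kernel-reducible by `decide`).
-/

namespace Summit.Ventures.QEC.Census.Fold

open Summit.Ventures.QEC.Census

/-! ## Xor-sums over lists and the structural linear map -/

/-- `⊕_{x ∈ L} g x`. -/
def xorIdx {α : Type} (g : α → ℕ) : List α → ℕ
  | [] => 0
  | x :: L => g x ^^^ xorIdx g L

/-- The word with the listed bits (duplicates cancel). -/
def maskOf (J : List ℕ) : ℕ := xorIdx (fun j => 2 ^ j) J

/-- The structural linear map `u ↦ ⊕_{i<n, bit (i0+i) … }`: `lin g n i0 u = ⊕_{k < n, testBit u k} g (i0 + k)`. -/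
def lin (g : ℕ → ℕ) : ℕ → ℕ → ℕ → ℕ
  | 0, _, _ => 0
  | n + 1, i0, u => (if u % 2 = 1 then g i0 else 0) ^^^ lin g n (i0 + 1) (u / 2)

/-- The set bits of `u` among positions `i0 … i0+n−1` of the shifted word, as an increasing list
(`bitsOf n 0 u` = support of `u mod 2^n`). -/
def bitsOf : ℕ → ℕ → ℕ → List ℕ
  | 0, _, _ => []
  | n + 1, i0, u => if u % 2 = 1 then i0 :: bitsOf n (i0 + 1) (u / 2) else bitsOf n (i0 + 1) (u / 2)

/-- Parity of the number of set bits among the low `n` bits. -/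
def parity : ℕ → ℕ → ℕ
  | 0, _ => 0
  | n + 1, u => (u % 2 + parity n (u / 2)) % 2

/-! ## Torus index arithmetic -/

/-- A fold step: the big torus `ℤ_l × ℤ_m` (two blocks, `n = 2lm` qubits, `lm` checks) folded along `x`
(`ax = true`, `l` even, small torus `ℤ_{l/2} × ℤ_m`) or along `y` (`ax = false`, `m` even). -/
structure Geo where
  /-- big torus `x`-period -/
  l : ℕ
  /-- big torus `y`-period -/
  m : ℕ
  /-- fold axis: `true` = `x`, `false` = `y` -/
  ax : Bool

namespace Geo

variable (G : Geo)

/-- small `x`-period -/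
def ls : ℕ := if G.ax then G.l / 2 else G.l
/-- small `y`-period -/
def ms : ℕ := if G.ax then G.m else G.m / 2
/-- big qubit count -/
def n : ℕ := 2 * (G.l * G.m)
/-- small qubit count -/
def ns : ℕ := 2 * (G.ls * G.ms)
/-- big check count -/
def r : ℕ := G.l * G.m
/-- small check count -/
def rs : ℕ := G.ls * G.ms

/-- Fold of a big qubit index `(blk,a,b) ↦ (blk, a mod ls, b mod ms)`. -/
def foldIdx (J : ℕ) : ℕ :=
  let blk := J / (G.l * G.m)
  let a := J % (G.l * G.m) / G.m
  let b := J % (G.l * G.m) % G.m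
  blk * (G.ls * G.ms) + (a % G.ls) * G.ms + b % G.ms

/-- Fold of a big check index `(a,b) ↦ (a mod ls, b mod ms)`. -/
def foldRow (R : ℕ) : ℕ := (R / G.m % G.ls) * G.ms + R % G.m % G.ms

/-- The section: small qubit `(blk,a,b)` ↦ the big qubit with the same coordinates. -/
def emb (j : ℕ) : ℕ :=
  let blk := j / (G.ls * G.ms)
  let a := j % (G.ls * G.ms) / G.ms
  let b := j % (G.ls * G.ms) % G.ms
  blk * (G.l * G.m) + a * G.m + b

/-- The other point of the fibre of a big qubit (translate by `x^{l/2}` resp. `y^{m/2}`). -/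
def partner (J : ℕ) : ℕ :=
  let blk := J / (G.l * G.m)
  let a := J % (G.l * G.m) / G.m
  let b := J % (G.l * G.m) % G.m
  if G.ax then blk * (G.l * G.m) + ((a + G.l / 2) % G.l) * G.m + b
  else blk * (G.l * G.m) + a * G.m + (b + G.m / 2) % G.m

end Geo

/-- Translation of a qubit index on the torus `ℤ_l × ℤ_m` (both blocks) by `(da, db)`. -/
def transIdx (l m da db J : ℕ) : ℕ :=
  let blk := J / (l * m)
  let a := J % (l * m) / m
  let b := J % (l * m) % m
  blk * (l * m) + ((a + da) % l) * m + (b + db) % m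

/-- Translation of a check index on `ℤ_l × ℤ_m` by `(da, db)`. -/
def transRow (l m da db R : ℕ) : ℕ := ((R / m + da) % l) * m + (R % m + db) % m

/-- Translate the word with support list `J` (as a numeral). -/
def transMask (l m da db : ℕ) (J : List ℕ) : ℕ := xorIdx (fun j => 2 ^ transIdx l m da db j) J

/-! ## Two-block torus codes by exponent lists; columns and syndromes -/

/-- A two-block code on `ℤ_l × ℤ_m`: exponent lists of `A` (left block) and `B` (right block). -/
structure TCode where
  /-- `x`-period -/
  l : ℕ
  /-- `y`-period -/
  m : ℕ
  /-- exponents `(i,k)` of the monomials `xⁱyᵏ` of `A` -/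
  A : List (ℕ × ℕ)
  /-- exponents of `B` -/
  B : List (ℕ × ℕ)

namespace TCode

variable (C : TCode)

/-- qubit count `2lm` -/
def n : ℕ := 2 * (C.l * C.m)
/-- check count `lm` -/
def r : ℕ := C.l * C.m

/-- The `H^X` column of qubit `J = (blk,a,b)` as a numeral over the checks: check `(a−i, b−k)` for each
exponent `(i,k)` of the block's polynomial (tree convention `toMatrix (xⁱyᵏ) r c = 1 ↔ c = r + (i,k)`). -/
def col (J : ℕ) : ℕ :=
  let blk := J / (C.l * C.m)
  let a := J % (C.l * C.m) / C.m
  let b := J % (C.l * C.m) % C.m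
  xorIdx (fun ik : ℕ × ℕ => 2 ^ (((a + C.l - ik.1 % C.l) % C.l) * C.m + (b + C.m - ik.2 % C.m) % C.m))
    (if blk = 0 then C.A else C.B)

/-- The `H^X` row of check `R = (a,b)` as a numeral over the qubits (bit `J` set iff bit `R` of `col J`). -/
def row (R : ℕ) : ℕ :=
  xorIdx (fun J => if (C.col J).testBit R then 2 ^ J else 0) (List.range C.n)

/-- All `H^X` rows, check order `0 … lm−1` (for `CertBits.rowMatrix` / `synZero`). -/
def rows : List ℕ := (List.range C.r).map C.row

/-- Syndrome of a support list: `⊕_{J ∈ S} col J`. -/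
def syn (S : List ℕ) : ℕ := xorIdx C.col S

end TCode

/-! ## Certifying Gaussian elimination over `𝔽₂` on ≤ 16 columns -/

/-- A pivot structure for a column list `cs` (length `p`): pivot column positions `I` (indices into
`cs`, length `q`), pivot row bits `R` (length `q`), the inverse `N` of the `q × q` minor (column `k` of
`N` as a `q`-bit numeral: `N · e_k`), and for every column `j < p` its coefficient vector `Z[j]` over the
pivot columns (`q`-bit numeral). -/
structure Piv where
  /-- pivot column positions (indices into the column list) -/
  I : List ℕ
  /-- the pivot columns themselves (`= I.map (cs.getD · 0)`, cached; checked by `pivOK`) -/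
  PC : List ℕ
  /-- pivot row bit positions -/
  R : List ℕ
  /-- inverse minor, by columns (each a numeral over `q` bits) -/
  N : List ℕ
  /-- coefficients of every column over the pivot columns (numerals over `q` bits) -/
  Z : List ℕ
  /-- reduced basis vectors of the column span, `V[k]` having pivot bit `R[k]` (for the reduction `red`) -/
  V : List ℕ

/-- `⊕_{k < fuel, bit k of x} L[k]` (select list entries by the bits of `x`; proof-side form). -/
def selXor (L : List ℕ) (x : ℕ) : ℕ := lin (fun k => L.getD k 0) L.length 0 x

/-- The same, list-serial (the form the kernel evaluates; `selXorL_eq`). -/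
def selXorL : List ℕ → ℕ → ℕ
  | [], _ => 0
  | c :: L, x => (if x % 2 = 1 then c else 0) ^^^ selXorL L (x / 2)

/-- Restrict a row-numeral `v` to the listed row bits: bit `k0 + k` of the result = bit `R[k]` of `v`. -/
def restrictTo : List ℕ → ℕ → ℕ → ℕ
  | [], _, _ => 0
  | r :: R, k0, v => (if v.testBit r then 2 ^ k0 else 0) ^^^ restrictTo R (k0 + 1) v

/-- The pivot columns (cached field; `pivOK` checks it against `cs[I[0]], …`). -/
def Piv.pcols (P : Piv) (_cs : List ℕ) : List ℕ := P.PC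

/-- Coefficients of `v` over the pivot columns: `N · (v|_R)`. -/
def Piv.coef (P : Piv) (v : ℕ) : ℕ := selXorL P.N (restrictTo P.R 0 v)

/-- THE MEMBERSHIP TEST: `v` lies in the column span iff re-expanding its pivot coefficients gives `v`. -/
def Piv.test (P : Piv) (cs : List ℕ) (v : ℕ) : Bool := selXorL (P.pcols cs) (P.coef v) == v

/-- REDUCTION modulo the column span: clear the pivot bits using the reduced basis (linear in `v`;
vanishes on the span when it vanishes on the columns — checked by `pivOK`). -/
def Piv.red (P : Piv) (v : ℕ) : ℕ := v ^^^ selXorL P.V (restrictTo P.R 0 v)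

/-- VERIFY a pivot structure for `cs` (CORE): lengths; cached pivot columns; every column equals its claimed
combination of pivot columns; `N` inverts the minor (`N · (pcol_k |_R) = e_k`). -/
def pivOKcore (cs : List ℕ) (P : Piv) : Bool :=
  (P.I.length == P.R.length) && (P.N.length == P.I.length) && (P.Z.length == cs.length) &&
  (P.PC == P.I.map fun i => cs.getD i 0) &&
  (P.I.all fun i => i < cs.length) &&
  ((List.zipIdx cs).all fun cj => selXorL (P.pcols cs) (P.Z.getD cj.2 0) == cj.1) &&
  ((List.zipIdx (P.pcols cs)).all fun ck => P.coef ck.1 == 2 ^ ck.2)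

/-- VERIFY additionally that the reduction `red` kills every column (soundness of PRUNING). -/
def pivOK (cs : List ℕ) (P : Piv) : Bool := pivOKcore cs P && (cs.all fun c => P.red c == 0)

/-- Place a `q`-bit coefficient vector at the pivot positions: `⊕_{k: bit k} 2^{I[k]}`. -/
def Piv.embedI (P : Piv) (y : ℕ) : ℕ := selXorL (P.I.map fun i => 2 ^ i) y

/-- Kernel generators of the column list: `e_j ⊕ embedI Z[j]` for every position `j < p`, the zero ones
dropped (for a pivot column `Z[j]` is its own unit vector and the generator vanishes). -/
def Piv.kerGens (P : Piv) (p : ℕ) : List ℕ :=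
  ((List.range p).map fun j => 2 ^ j ^^^ P.embedI (P.Z.getD j 0)).filter fun k => !(k == 0)

/-- All subset-xors of a list (`2^{|K|}` numerals, with repetitions if dependent). -/
def spanAll : List ℕ → List ℕ
  | [] => [0]
  | k :: K => let S := spanAll K; S ++ S.map fun x => x ^^^ k

/-- ALL solutions `x ⊆ [p]` (as numerals) of `⊕_{i ∈ x} cs[i] = v`, given a verified pivot structure:
`embedI (coef v) ⊕ spanAll kerGens` if the membership test passes, else none. -/
def Piv.solutions (P : Piv) (cs : List ℕ) (v : ℕ) : List ℕ :=
  if P.test cs v then (spanAll (P.kerGens cs.length)).map fun k => P.embedI (P.coef v) ^^^ k else []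

/-- UNVERIFIED elimination (any bug here only makes `pivOK` fail, never soundness). State: the reduced
basis as a list of `(pivot bit, vector, combination over pivot slots)` in slot order, and the pivot column
positions `I`; columns are processed left to right (`j` = current position). -/
def gaussAux : List ℕ → ℕ → List (ℕ × ℕ × ℕ) → List ℕ → List (ℕ × ℕ × ℕ) × List ℕ
  | [], _, basis, I => (basis, I)
  | c :: cs, j, basis, I =>
    let red := basis.foldl (fun (vc : ℕ × ℕ) (bvk : ℕ × ℕ × ℕ) =>
      if vc.1.testBit bvk.1 then (vc.1 ^^^ bvk.2.1, vc.2 ^^^ bvk.2.2) else vc) (c, 0)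
    if red.1 == 0 then gaussAux cs (j + 1) basis I
    else
      let b := Nat.log2 red.1
      let q := I.length
      let cmb := red.2 ^^^ 2 ^ q
      let basis' := basis.map fun (bvk : ℕ × ℕ × ℕ) =>
        if bvk.2.1.testBit b then (bvk.1, bvk.2.1 ^^^ red.1, bvk.2.2 ^^^ cmb) else bvk
      gaussAux cs (j + 1) (basis' ++ [(b, red.1, cmb)]) (I ++ [j])

/-- UNVERIFIED: pivot structure of a column list (`pivOK` is the judge).  Slot `k` = the `k`-th pivot
found; `R[k]` its pivot bit; `N · e_k` = the combination (over pivot columns) of the `k`-th reduced basis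
vector (the reduced basis restricted to the pivot rows is the identity, so these combinations invert the
minor); `Z[j] = coef (cs[j])`. -/
def gaussPiv (cs : List ℕ) : Piv :=
  let res := gaussAux cs 0 [] []
  let P : Piv := ⟨res.2, res.2.map (fun i => cs.getD i 0), res.1.map (fun bvk => bvk.1), res.1.map (fun bvk => bvk.2.2), [],
    res.1.map (fun bvk => bvk.2.1)⟩
  ⟨P.I, P.PC, P.R, P.N,
    (List.zipIdx cs).map (fun cj => let k := P.I.idxOf cj.2; if k < P.I.length then 2 ^ k else P.coef cj.1), P.V⟩

/-! ## Include/skip scan of the outside columns -/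

/-- For the outside columns `O` (triples `(o, M o, red (M o))`) and budget `s`: all pairs `(e, x)` —
`e ⊆ O` a sub-list with `|e| ≤ s` whose residual `v = h ⊕ M_e` reduces to `0` (PRUNING: otherwise no
solution exists), `x` a listed solution of `M_P x = v`.  Accumulators: `v`, its reduction `rv`, the
chosen `e` (reversed); budget `0` is a leaf (append form: the kernel's term depth stays `≤ |O|`). -/
def scan (Pv : Piv) (MP : List ℕ) : List (ℕ × ℕ × ℕ) → ℕ → ℕ → ℕ → List ℕ → List (List ℕ × ℕ)
  | [], _, v, rv, e => if rv == 0 then (Pv.solutions MP v).map fun x => (e, x) else []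
  | _ :: _, 0, v, rv, e => if rv == 0 then (Pv.solutions MP v).map fun x => (e, x) else []
  | oc :: O, s' + 1, v, rv, e =>
    scan Pv MP O s' (v ^^^ oc.2.1) (rv ^^^ oc.2.2) (oc.1 :: e) ++ scan Pv MP O (s' + 1) v rv e

/-! ## The fibre system of a fold step -/

/-- Fibre-system column of small index `j`: `col_big (emb j) ⊕ col_big (partner (emb j))`. -/
def fcol (G : Geo) (C : TCode) (j : ℕ) : ℕ := C.col (G.emb j) ^^^ C.col (G.partner (G.emb j))

/-- Partner column of small index `j`: `col_big (partner (emb j))` (the right-hand side columns). -/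
def pcol (G : Geo) (C : TCode) (j : ℕ) : ℕ := C.col (G.partner (G.emb j))

/-- Right-hand side of the fibre system for support list `P` of `t`: `⊕_{j ∈ P} pcol j`, through a
column function `Mp` (= `pcol`, usually tabulated). -/
def frhs (Mp : ℕ → ℕ) (P : List ℕ) : ℕ := xorIdx Mp P

/-- The big word of a fibre solution: `t` with support `P`, doubled outside positions `e`, and the
selection numeral `x` over `P` (bit `k` ↦ `a_{P[k]} = 1`): support list
`emb e ++ partner(emb e) ++ [emb P[k] | x_k = 1] ++ [partner (emb P[k]) | x_k = 0]`. -/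
def mkWord (G : Geo) (P e : List ℕ) (x : ℕ) : List ℕ :=
  e.map G.emb ++ e.map (fun j => G.partner (G.emb j)) ++
    xorSelIdx P x
where
  /-- the `P`-part: `emb P[k]` if bit `k` of `x`, else `partner (emb P[k])` -/
  xorSelIdx : List ℕ → ℕ → List ℕ
  | [], _ => []
  | j :: P', x => (if x % 2 = 1 then G.emb j else G.partner (G.emb j)) :: xorSelIdx P' (x / 2)

/-- The positions `< n` outside the support list `P` (increasing), read off the complement mask
(one pass over `n` bits instead of `n·|P|` list-membership tests). -/
def outsideOf (n : ℕ) (P : List ℕ) : List ℕ := bitsOf n 0 ((2 ^ n - 1) ^^^ maskOf P)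

/-- THE FIBRE ENUMERATOR: all big kernel words of weight `≤ W` folding exactly onto the small word with
support list `P` (increasing, inside `[0, ns)`), as support lists.  `M` = the fibre column function
(= `fcol`, tabulated), `Mp` = the partner column function (= `pcol`).  Outside columns = the small
indices not in `P`; budget `s = (W − |P|)/2`; pivot structure computed by `gaussPiv` and REQUIRED to
verify (`pivOK`) — otherwise the enumerator reports failure (`none`). -/
def fiber (G : Geo) (M Mp : ℕ → ℕ) (W : ℕ) (P : List ℕ) : Option (List (List ℕ)) :=
  let MP := P.map M
  let Pv := gaussPiv MP
  let s := (W - P.length) / 2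
  let h := frhs Mp P
  let Ob := outsideOf G.ns P
  if 2 ≤ s then
    if pivOK MP Pv then
      some ((scan Pv MP (Ob.map fun o => (o, M o, Pv.red (M o))) s h (Pv.red h) []).map fun ex => mkWord G P ex.1 ex.2)
    else none
  else
    if pivOKcore MP Pv then
      some ((scan Pv MP (Ob.map fun o => (o, M o, 0)) s h 0 []).map fun ex => mkWord G P ex.1 ex.2)
    else none

/-! ## Matching a word against class representatives up to translation -/

/-- Hash key of a numeral for the representative store: residue modulo `md` (`+1`: key `0` is unused by
`KRupFast.Store`). -/
def hkey (md : ℕ) (w : ℕ) : ℕ := w % md + 1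

/-- The store of representatives (each inserted at its hash key, trie depth fuel `40`, so `md < 2^39`;
collisions among representatives must be avoided by the emitter — a collision only loses matches, never
soundness). -/
noncomputable def repStore (md : ℕ) (reps : List ℕ) : KRupFast.Store :=
  reps.foldl (fun S w => KRupFast.Store.ins 40 S (hkey md w) w) .nil

/-- Anchored forms of a support list on the torus `ℤ_l × ℤ_m`: translate so that each of its points in
turn lands on coordinates `(0,0)` of its block. -/
def anchors (l m : ℕ) (S : List ℕ) : List (ℕ × ℕ) :=
  S.map fun J => let a := J % (l * m) / m; let b := J % (l * m) % m; ((l - a) % l, (m - b) % m)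

/-- MATCH: some anchored translate of the support list `S` is (as a numeral) a stored representative,
or `S` is empty and `0` is a representative. Returns the witnessing translation. -/
noncomputable def matchRep (l m md : ℕ) (store : KRupFast.Store) (zeroOK : Bool) (S : List ℕ) :
    Option (ℕ × ℕ) :=
  match S with
  | [] => if zeroOK then some (0, 0) else none
  | _ =>
    (anchors l m S).find? fun d =>
      let w := transMask l m d.1 d.2 S
      let v := store.get (hkey md w)
      !(v == 0) && (v == w)

/-! ## Linear pre-filter (`Res`) and the per-word driver -/

/-- Signature of a support list under packed functionals: `Φ` holds `c` functionals, coordinate `j`'s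
`c`-bit signature at bits `c·j … c·j+c−1`; a word passes iff its signature is `0`. -/
def sig (c Φ : ℕ) (S : List ℕ) : ℕ := xorIdx (fun j => (Φ >>> (c * j)) % 2 ^ c) S

end Summit.Ventures.QEC.Census.Fold
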